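import Summits.BirchSwinnertonDyer.BirchSwinnertonDyer.Theorems.SignedBaseChangeAnticyclotomicEisensteinDivisibilityGreenbergRoadOfTateTC
import Summits.BirchSwinnertonDyer.BirchSwinnertonDyer.Theorems.SignedBaseChangeAnticyclotomicEisensteinDivisibilityTwistDeformationLOC1
import Summits.BirchSwinnertonDyer.BirchSwinnertonDyer.Theorems.SignedBaseChangeAnticyclotomicEisensteinDivisibilityLocalEulerPoincareCorank
import Summits.BirchSwinnertonDyer.BirchSwinnertonDyer.Theorems.PrintCf2SplitBadTwoTwoVarSpecializationFiniteJunk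
import Literature.NumberTheory.IwasawaTheory.Greenberg2006.GlobalEulerPoincareCorankOfTateTC
import Literature.NumberTheory.IwasawaTheory.Greenberg2016.LocalCohomologyAlmostDivisible
import Literature.NumberTheory.IwasawaTheory.Greenberg2006.LocalH2VanishingOfLOC1
import Literature.NumberTheory.GaloisCohomology.RestrictedRamificationPoitouTateThreeLeTotallyComplex
import HarnessLib

/-!
# Line `thin_comb` (v3) on the WALL `AdditiveSplitIMCInclusionAtThree` (stmt-BirchSwinnertonDyer-20395) — the support stub
# `stub_noPseudoNull` CLOSED MODULO TWO PUBLISHED NAMED FACTS (Greenberg 2016 Prop. 4.1.1; Milne ADT I Thm. 5.1 at totally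
# complex fields), by the sibling cell's Greenberg road (helper, `--supports stmt-BirchSwinnertonDyer-20395`; cell `pub/bsd-wall`,
# lead `cruxlead-20395` g3)

`stub_noPseudoNull` (v3) asks, at `p = 3` split in the imaginary quadratic `K` and in ANY generator pair `(κ₁, κ₂; γ₁, γ₂)` of the
`ℤ₃²`-tower: if `X₂ = XGr₂ (W/K) 3 κ₁ κ₂ 𝔭′ γ₁ γ₂ = X_{∅ at 𝔭, nr at 𝔭′}(E/K̃_∞)` is finitely generated and torsion over `Λ₂`, then
every pseudo-null `Λ₂`-submodule of `X₂` is finite. The cell `bsd-ssimc` (route `SignedBaseChange`, crux stmt-…-20727, line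
`bdpline` v37) built, for the SAME tree carrier `XGr₂` and ANY elliptic `W/K`, the Greenberg-2016 road
`SignedBaseChangeAcDivGreenbergRoadOfTateTC.xGr₂_hasNoPseudoNullSubmodule_curve_ofTateTC`: `X_Gr(E/K̃_∞)` has NO non-zero
pseudo-null submodule granted Greenberg 2016 Props. 4.1.1 / 4.2.2, Greenberg 2006 §5 A / Props. 4.1 / 4.2 BY NAME, Tate's global
Euler characteristic at totally complex fields BY NAME, torsion, and the two kernel bricks (R1a) `E[p^∞]` cofree with a Tate-dual
basis (`isCofree_primaryTorsion`, `exists_tateDual_basis_primaryTorsion`) and (R1b) LOC⁽¹⁾ / `corank H⁰ = 0` for the twist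
deformation (`SignedBaseChangeAcDivTwistLOC1.loc1_and_hasCorank_H0_zero_curve`, ANY generator pair, ANY `ρ₀`). Of the five Greenberg
facts, three are tree theorems (`prop422_localCohomology_isAlmostDivisible_holds`, `sec5A_localH2_subsingleton_of_LOC1_holds`,
`prop42_localEulerPoincareCorank_holds`) and Prop. 4.1 follows from Tate (TC) and the PROVED Harari Thm. 17.13 (a) at totally
complex fields (`prop41_of_tate_of_poitouTate_three_le_of_isTotallyComplex`). This file assembles that for our stub:

* `xGr₂_hasNoPseudoNullSubmodule_of_prop411_of_tateTC` — any elliptic `W/K`, `K` imaginary quadratic, `2 < p = v v̄`, any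
  generator pair, `X_Gr₂` torsion ⟹ no non-zero pseudo-null submodule, GRANTED ONLY `prop411_selmer_isAlmostDivisible` and
  `∀ L totally complex, tateGlobalEulerPoincareCharacteristic L`;
* `stub_noPseudoNull_of_prop411_of_tateTC` — the registered signature of `stub_noPseudoNull` VERBATIM, under the same two facts.

HONEST FRAMING: CONDITIONAL on two PUBLISHED named facts carried as hypotheses (both already in the tree's debt queue, consumed by
the sibling lines `bdpline` / `halves`); closes nothing by itself; BSD is not proved by any of this.

References: [Greenberg2016Selmer] Prop. 4.1.1 (c) p. 15, Prop. 4.2.2 p. 20, §4.3; [Greenberg2006] Props. 3.2, 4.1, 4.2, §5 A;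
[Greenberg2010] Lemma 5.2.2; [MilneADT2006] I Thm. 5.1 (p. 67); [Harari2020] Thm. 17.13 (a); [BurungaleCastellaSkinner2025] §2.1.
-/

set_option linter.dupNamespace false
set_option autoImplicit false

noncomputable section

open scoped Classical
open NumberField IsDedekindDomain Field
open Literature.NumberTheory.EllipticCurves Literature.NumberTheory.GaloisRepresentations
  Literature.NumberTheory.GaloisCohomology
  Literature.NumberTheory.IwasawaTheory Literature.NumberTheory.IwasawaTheory.Greenberg2006
  Literature.NumberTheory.IwasawaTheory.Greenberg2016
  Summit.BirchSwinnertonDyer.BirchSwinnertonDyer.Theorems.GreenbergFullAtSelmer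
  Summit.BirchSwinnertonDyer.BirchSwinnertonDyer.Theorems.AcTwistDeformation
  Summit.BirchSwinnertonDyer.BirchSwinnertonDyer.Theorems.TwistDeformationCofree
  Summit.BirchSwinnertonDyer.BirchSwinnertonDyer.Theorems.SignedBaseChangeAcDivFiniteExponent
  Summit.BirchSwinnertonDyer.BirchSwinnertonDyer.Theorems.SignedBaseChangeAcDivGreenbergSqueeze
  Summit.BirchSwinnertonDyer.BirchSwinnertonDyer.Theorems.SignedBaseChangeAcDivCurveModel
  Summit.BirchSwinnertonDyer.BirchSwinnertonDyer.Theorems.SignedBaseChangeAcDivAssembly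
  Summit.BirchSwinnertonDyer.BirchSwinnertonDyer.Theorems.SignedBaseChangeAcDivFiniteExponentTelescope
  Summit.BirchSwinnertonDyer.BirchSwinnertonDyer.Theorems.SignedBaseChangeAcDivCofree
  Summit.BirchSwinnertonDyer.BirchSwinnertonDyer.Theorems.SignedBaseChangeAcDivTwistLOC1
  Summit.BirchSwinnertonDyer.BirchSwinnertonDyer.Theorems.SignedBaseChangeAcDivGreenbergRoadOfTateTC

namespace Summit.BirchSwinnertonDyer.BirchSwinnertonDyer.Theorems.UniversalToricDescentThinComb.DescentNoPseudoNullOfFacts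

/-- **`X_Gr(E/K̃_∞)` has no non-zero pseudo-null `Λ₂`-submodule, GRANTED ONLY Greenberg 2016 Prop. 4.1.1 and Tate's global Euler
characteristic at totally complex fields** (`W/K` elliptic, `K` imaginary quadratic, `2 < p = v v̄` split, ANY generator pair,
`X_Gr₂` torsion): the sibling road `xGr₂_hasNoPseudoNullSubmodule_curve_ofTateTC` with the auxiliary set
`S = {w ∣ p} ∪ {bad w}`, the descended `ρ₀`, the bricks (R1a)/(R1b) and the three proved Greenberg facts plugged in.
[cite: Greenberg2016Selmer, Prop. 4.1.1 (c) (§4.1 p. 15), §4.3 pp. 20–21] [cite: Greenberg2006, Props. 4.1, 4.2, §5 A]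
[cite: Greenberg2010, Lemma 5.2.2] [cite: MilneADT2006, I Thm. 5.1 (p. 67)] [cite: Harari2020, Thm. 17.13 (a)] -/
theorem xGr₂_hasNoPseudoNullSubmodule_of_prop411_of_tateTC {K : Type} [Field K] [NumberField K] {p : ℕ} [Fact p.Prime]
    (W : WeierstrassCurve K) [W.IsElliptic] (κ₁ κ₂ : ZpExtension K p) (vbar : HeightOneSpectrum (𝓞 K))
    (γ₁ γ₂ : absoluteGaloisGroup K) [hγ : Fact (ZpExtension.IsTopGeneratorPair κ₁ κ₂ γ₁ γ₂)]
    (h411 : prop411_selmer_isAlmostDivisible)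
    (hT : ∀ (L : Type) [Field L] [NumberField L] [IsTotallyComplex L], tateGlobalEulerPoincareCharacteristic L)
    (hp : 2 < p) (hK : IsImaginaryQuadratic K)
    {v : HeightOneSpectrum (𝓞 K)} (hv : ((p : ℕ) : 𝓞 K) ∈ v.asIdeal)
    (hvbar : ((p : ℕ) : 𝓞 K) ∈ vbar.asIdeal) (hne : vbar ≠ v)
    (htors : Module.IsTorsion (IwasawaAlgebra₂ p) (W.XGr₂ p κ₁ κ₂ vbar γ₁ γ₂)) :
    HasNoPseudoNullSubmodule (IwasawaAlgebra₂ p) (W.XGr₂ p κ₁ κ₂ vbar γ₁ γ₂) := by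
  -- the discrete topological instances of the road's model
  letI tΛ₁ : TopologicalSpace (PowerSeries ℤ_[p]) := ⊥
  letI tΛ₂ : TopologicalSpace (PowerSeries (PowerSeries ℤ_[p])) := ⊥
  haveI : DiscreteTopology (PowerSeries (PowerSeries ℤ_[p])) := ⟨rfl⟩
  haveI : IsTopologicalRing (PowerSeries (PowerSeries ℤ_[p])) := inferInstance
  haveI : IsTopologicalAddGroup (IndModule₂ ℤ_[p] p (PrimaryTorsion W.geomPoints p)) := inferInstance
  haveI : ContinuousSMul (PowerSeries (PowerSeries ℤ_[p])) (IndModule₂ ℤ_[p] p (PrimaryTorsion W.geomPoints p)) :=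
    inferInstance
  -- the auxiliary set `S = {w ∣ p} ∪ {bad w}`
  set S : Set (HeightOneSpectrum (𝓞 K)) :=
    {w : HeightOneSpectrum (𝓞 K) | ((p : ℕ) : 𝓞 K) ∈ w.asIdeal ∨ ¬ W.HasGoodReductionAt w} with hSdef
  have hS : ∀ w : HeightOneSpectrum (𝓞 K), ((p : ℕ) : 𝓞 K) ∈ w.asIdeal → w ∈ S :=
    mem_badOrP_of_natCast_mem W p
  have hSbad : ∀ w : HeightOneSpectrum (𝓞 K), ¬ W.HasGoodReductionAt w → w ∈ S := fun w hw ↦ Or.inr hw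
  have hSf : S.Finite := by
    refine ((IsDedekindDomain.HeightOneSpectrum.finite_setOf_natCast_mem (R := 𝓞 K)
      (Fact.out : p.Prime).ne_zero).union (W.finite_badPlaces_holds (𝓞 K))).subset ?_
    rintro w (hw | hw)
    · exact Or.inl hw
    · exact Or.inr hw
  -- Néron–Ogg–Shafarevich and the descended `ρ₀`
  have hNS : ∀ n ∈ ramificationSubgroup K S, ∀ P : PrimaryTorsion W.geomPoints p, n • P = P :=
    fun n hn P ↦ smul_primaryTorsion_eq_of_mem_ramificationSubgroup W p S hSbad hS hn P
  obtain ⟨ρ₀, hρ₀⟩ := exists_continuousRep_primaryTorsion W p S hNS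
  -- (R1b): LOC⁽¹⁾ and `corank H⁰ = 0` for the twist deformation, any generator pair, any `ρ₀`
  obtain ⟨hLOC1, h0loc, h00⟩ := loc1_and_hasCorank_H0_zero_curve W κ₁ κ₂ hK hγ.out S hS ρ₀
  -- the road, with (R1a) and the three proved Greenberg facts, Prop. 4.1 from Tate (TC) + Harari 17.13 (a) (TC)
  exact xGr₂_hasNoPseudoNullSubmodule_curve_ofTateTC W hS κ₁ κ₂ ρ₀ vbar γ₁ γ₂ h411
    prop422_localCohomology_isAlmostDivisible_holds sec5A_localH2_subsingleton_of_LOC1_holds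
    (prop41_of_tate_of_poitouTate_three_le_of_isTotallyComplex hT
      forall_poitouTate_restricted_three_le_of_isTotallyComplex)
    prop42_localEulerPoincareCorank_holds hT hSf hp hK hv hvbar hne hNS hρ₀ htors
    (isCofree_primaryTorsion W p) (exists_tateDual_basis_primaryTorsion W p)
    (fun w _ ↦ hLOC1 w) (fun w _ ↦ h0loc w) h00

/-- **`stub_noPseudoNull` of line `thin_comb` v3 (the registered signature VERBATIM), GRANTED ONLY Greenberg 2016 Prop. 4.1.1 and
Tate's global Euler characteristic at totally complex fields**: at `p = 3 = 𝔭𝔭′` split in the imaginary quadratic `K`, in any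
generator pair, `X_{∅ at 𝔭, nr at 𝔭′}(E/K̃_∞)` torsion ⟹ every pseudo-null `Λ₂`-submodule is finite (indeed `⊥`:
`xGr₂_hasNoPseudoNullSubmodule_of_prop411_of_tateTC` + `hasNoPseudoNullSubmodule_iff` +
`PrintCf2.TwoVarSpecializationFinite.pseudoNull_finite_of_noPseudoNull`). The frame hypotheses of the stub are not used.
[cite: Greenberg2016Selmer, Prop. 4.1.1 (c) (§4.1 p. 15)] [cite: MilneADT2006, I Thm. 5.1 (p. 67)] -/
theorem stub_noPseudoNull_of_prop411_of_tateTC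
    (h411 : prop411_selmer_isAlmostDivisible)
    (hT : ∀ (L : Type) [Field L] [NumberField L] [IsTotallyComplex L], tateGlobalEulerPoincareCharacteristic L) :
    ∀ (W : WeierstrassCurve ℚ) [W.IsElliptic] [W.IsGloballyMinimal] (K : Type) [Field K] [NumberField K],
    Summit.BirchSwinnertonDyer.Rank1Residual.Additive.ClassO6 W 3 → W.HasSurjectiveModNGaloisRep 3 →
    IsImaginaryQuadratic K →
    ∀ (κ : ZpExtension K 3), κ.IsAnticyclotomic → ∀ (γ : Field.absoluteGaloisGroup K) [Fact (κ.IsTopGenerator γ)]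
      (𝔭 : HeightOneSpectrum (𝓞 K)), ((3 : ℕ) : 𝓞 K) ∈ 𝔭.asIdeal →
    ∀ (𝔭' : HeightOneSpectrum (𝓞 K)), ((3 : ℕ) : 𝓞 K) ∈ 𝔭'.asIdeal → 𝔭' ≠ 𝔭 →
    ∀ (κ₁ κ₂ : ZpExtension K 3) (γ₁ γ₂ : Field.absoluteGaloisGroup K) (k : ℕ)
      [Fact (ZpExtension.IsTopGeneratorPair κ₁ κ₂ γ₁ γ₂)],
    (∀ v : HeightOneSpectrum (𝓞 K), v ≠ 𝔭 → ∀ 𝔓 ∈ v.primesAbove,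
        𝔓.inertia (Field.absoluteGaloisGroup K) ≤ κ₁.kerSubgroup) →
    ZpExtension.pairKer κ₁ κ₂ ≤ κ.kerSubgroup → γ₁ * γ⁻¹ ∈ κ.kerSubgroup → γ₂ * (γ ^ (3 ^ k))⁻¹ ∈ κ.kerSubgroup →
    Module.Finite (IwasawaAlgebra₂ 3) ((W.baseChange K).XGr₂ 3 κ₁ κ₂ 𝔭' γ₁ γ₂) →
    Module.IsTorsion (IwasawaAlgebra₂ 3) ((W.baseChange K).XGr₂ 3 κ₁ κ₂ 𝔭' γ₁ γ₂) →
    ∀ N : Submodule (IwasawaAlgebra₂ 3) ((W.baseChange K).XGr₂ 3 κ₁ κ₂ 𝔭' γ₁ γ₂),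
      Literature.NumberTheory.EllipticCurves.Module.IsPseudoNull (IwasawaAlgebra₂ 3) N → Finite N := by
  intro W _ _ K _ _ _hO6 _hsurj hK κ _hκ γ _ 𝔭 h3 𝔭' h3' hne κ₁ κ₂ γ₁ γ₂ _k _ _hur₁ _hker _hγ₁ _hγ₂ hfin htors
  haveI : (W.baseChange K).IsElliptic := by rw [WeierstrassCurve.baseChange]; infer_instance
  haveI := hfin
  have hPN := xGr₂_hasNoPseudoNullSubmodule_of_prop411_of_tateTC (W.baseChange K) κ₁ κ₂ 𝔭' γ₁ γ₂ h411 hT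
    (by norm_num) hK h3 h3' hne htors
  exact Summit.BirchSwinnertonDyer.BirchSwinnertonDyer.Theorems.PrintCf2.TwoVarSpecializationFinite.pseudoNull_finite_of_noPseudoNull
    3 ((W.baseChange K).XGr₂ 3 κ₁ κ₂ 𝔭' γ₁ γ₂) ((hasNoPseudoNullSubmodule_iff _).1 hPN)

end Summit.BirchSwinnertonDyer.BirchSwinnertonDyer.Theorems.UniversalToricDescentThinComb.DescentNoPseudoNullOfFacts

end
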